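import Summits.QuantumFields.YangMills.Theorems.BalabanUVNodesN12AtRecord13LiveLine
import Literature.MathematicalPhysics.QuantumFieldTheory.Balaban1983to89.B15Claim189PinsOfHistory

/-!
# BalabanUVNodes ∕ N12 AT THE TERM-PINNED STAGE-13 LAYERS ON THE LIVE LINE — the [IV] leaf at the live re-pin's bundle of record `WOfRecord₁₃ (Θ.liveRepin₁₃) λᵀ P` with the (1.100) data
# pinned to Record 13's 𝐑-step (`λ.pinRPrime₁₃`, dag-n12-e module 14) and the (1.89) letters pinned to the term's situation along the Stage-13 history (`pinD189TH ∕ ZH`, per-run memory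
# `N P`, `N₀ P`): NO (1.89) display, NO fibre witness, the pin equation `rfl`, the mass display in the live form; non-vacuity at `(1,0)` with admissibility DISCHARGED
# (the ₁₃ twin of this seat's g5 `…AtRecord12TermPinned ∕ …TermPinnedFlow ∕ …TermPinnedN0`; Track A, DAG node N12 = [B15, Balaban1989LargeFieldI] CMP **122** (1989) 175–202;
# cluster K1‴ `StabilityBAtRecordR13e` = stmt-QuantumFields-19910; seat `pub-ymgap-dag-n12-d` g6 (R134 s2), 2026-08-27; count-neutral, NOT a discharge)

HONEST FRAMING.  Count-neutral kernel BOOKKEEPING BY NAME over module 12B (`b15Leaf_WOfRecord₁₃_liveRepin₁₃_of_massLive`: `Provisos₁₃` at the re-pin + pin equation + live-mass + Prop 1 + (1.80) +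
(1.89) ⇒ the leaf, `hfib` free) and dag-n12-e's module 14 `B15Claim189PinsOfHistory` (`ResidW.pinRPrime₁₃`, `ResidW.pinD189TH ∕ pinD189ZH`, `sitOfHist`, `N0OfRecord₁₃`, the (1.89) display
theorems `claim189_sitOfHist_of_flow ∕ claim189_sitOfHist_N0Z_of_flow ∕ claim189_sitOfHist₁₃_N0_of_inInterval`, the unit test `displays_tested_at_one_pinD189TH`).  Nothing of Bałaban's is asserted:
the (1.89) CONJUNCT of the leaf is DISCHARGED from its printed inputs — (1.80) at the pinned `dev0`, the four ℍ-leaves (1.90)–(1.97) ([B11] at the objects, N07), the located geometry (shell bound,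
(1.88) cover, «We have j = k» unless `Z″` is pinned), the residual numerics with print's second p.200 condition, and the window ∕ flow inputs — all DISPLAYED; `Provisos₁₃` at the re-pin (K0‴), the
live-mass display (NODE 00), Prop. 1 (dag-n12-c) DISPLAYED; N12 NOT discharged.  SPLIT with dag-n12-e g5 (bus l.≈16330, as at ₁₂): the θ-GENERIC term-pinned leaf at Record 13 (`hfib`,
`hmassSel` displayed) is his `Thm/BalabanUVNodesN12AtRecord13TermPin`; this file is the LIVE-RE-PIN layer, composed directly over module 14 (no restatement of either).

* §1 NON-VACUITY (admissibility DISCHARGED): `displays_tested_at_one_pinAllTH_liveRepin₁₃` ∕ `new189_pinAllTH_liveRepin₁₃_one_zero` — at admissible `Θ`, on every run whose ₁₃ history lies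
  in the window `]0, Θ.γ]` up to `n ≥ kSel P + 1`, at `U = (1, 0)` the antecedent `new189 (λᵀ.D189 P)` HOLDS, the (1.80) body HOLDS and `χ″_k` HOLDS (module 14's unit test with
  `0 < εreg ∕ A₀ ∕ A₁`, `γ < 1` READ OFF `Θ.Admissible`): the displays below are never vacuous there.
* §2 THE LEAF AT `λᵀ := (λ.pinRPrime₁₃ θL).pinD189TH θL.ν θL.A₁ θL.τ9.M (gOfRecord₁₃ θL) σ s N N₀ p₁`, `θL := Θ.liveRepin₁₃`, run with `kSel P < K`:
  ★ `b15Leaf_WOfRecord₁₃_pinAllTH_liveRepin₁₃_of_massLive_of_flow` (WINDOW-FREE: levels `2 ≤ N₀ P ≤ N P`, `N₀ P ≤ kSel P + 1` and the flow inputs `hε0 ∕ hε1 ∕ hflow` displayed — the form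
  usable at K0a's witness of record, where `γ = ½` voids every `SmallnessFor` window);
  ★ `b15Leaf_WOfRecord₁₃_pinAllTH_N0_liveRepin₁₃_of_massLive_of_h180` (`N₀ P := N0OfRecord₁₃ θL P (kSel P + 1)`, the run in a (2.7)-small window `SmallnessFor Θ.γ …` up to `kSel P + 1`,
  `BetaUpperH β′ Θ.γ (betaOfRecord₁₃ θL)`: `2 ≤ N₀` and print's first p.200 condition DISCHARGED by module 14 — the form for K0a's all-numerics members with `n.γ` small);
  ★ `b15Leaf_WOfRecord₁₃_pinAllZH_N0_liveRepin₁₃_of_massLive_of_flow` (`Z″_j` pinned to the term's chain: «We have j = k» DISCHARGED; window-free).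
  In all three: `hpin := rfl`, `hfib` GONE, the mass display = positive mass of the LIVE pre-𝐑 terms at level `kSel P + 1`.
A closer feeds these per run into 12B's `b15Leaf_WOfRecord₁₃_liveRepin₁₃_all_of_massLive` ∕ `nodesAtSomeRecord₁₃_of_fourPin_liveRepin₁₃_of_massLive` (or dag-n24-c's h12-handed sockets 41 ∕ 42)
with `lamW := λᵀ`.  WHAT N12 THEN COSTS PER RUN ON THE STAGE-13 LIVE LINE (typing strength, NOT a second gap): `Provisos₁₃ (Θ.liveRepin₁₃)`; live-mass at level `kSel P + 1`; Prop. 1 at `λ.LF P`;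
(1.80) + the four ℍ-leaves at the pinned letters; the situation's residual numbers (`β, L₀, δ, B₃, B₅, O(1), dist`) with print's second p.200 condition; the located geometry; per-run
memory `N P ≥ N₀ P`; a window with (2.7)-small `γ` OR the flow inputs; ONE TERM `s P` per run; for runs with `K ≤ kSel P` the leaf itself.  One finite four-torus programme at fixed `ε`;
nothing continuum ∕ ℝ⁴ ∕ OS ∕ mass gap ∕ Clay.  0 `sorry`, 0 `def`, standard axioms.  Filed `--supports` K1‴ (stmt-QuantumFields-19910) `--as helper`.
Sources: [Balaban1989LargeFieldI] (0.2)–(0.6) pp.176–177, Prop. 1 p.194, (1.80) p.195, (1.82) p.196, (1.88)–(1.90) pp.197–198, pp.199–201; [Balaban1988Convergent] (2.1) p.254,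
(2.4)–(2.8) pp.255–256, (3.22)–(3.25) pp.269–270; [Balaban1987RG1] (1.22) p.264; [Balaban1989LargeFieldII] Thm 1 + (0.1) pp.355–356.
-/

noncomputable section

open MeasureTheory
open scoped Matrix.Norms.L2Operator

namespace Summit.QuantumFields.YangMills.BalabanUVNodes.N12AtRecord13TermPinned

open Literature.MathematicalPhysics.QuantumFieldTheory.Balaban1983to89
open Literature.MathematicalPhysics.QuantumFieldTheory.Balaban1983to89.T4Continuum (T4Family)
open Literature.MathematicalPhysics.QuantumFieldTheory.Balaban1983to89.DagBinding (PrintedCarriers15 B15Leaf)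
open Literature.MathematicalPhysics.QuantumFieldTheory.Balaban1983to89.Node00
open FlowStep (BetaUpperH prefixOf)
open B14FlowStep (SmallnessFor)
open B15Claim189Assembly (Setting189 new189 chiPP dom half)
open B15 (Prop1Printed Ineq180)
open B15.BasicStep (Claim189)
open B15.PrelimIntegrations (Ineq191 Ineq195)
open B15Chi124DetSets (E124)
open B15DeterminingSets (MSField)
open B14DomainGeom (Pt)
open B8Eq17ClassAkV1 (plaqsOf)
open GaugeGroup (dist1)
open GaugeField (plaqHol)
open B15Claim189PrintedConditions (omegaOfChain)
open B15Claim189PinsOfHistory (sitOfHist N0OfRecord₁₃ D189OfHist claim189_sitOfHist_of_flow claim189_sitOfHist_N0Z_of_flow claim189_sitOfHist₁₃_N0_of_inInterval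
  displays_tested_at_one_pinD189TH)
open Summit.QuantumFields.YangMills.BalabanUVNodes.N12AtRecord13LiveLine (b15Leaf_WOfRecord₁₃_liveRepin₁₃_of_massLive)

variable {N : ℕ} [NeZero N] {F : T4Family}

/-! ## §1 NON-VACUITY on the live line: at admissible `Θ` both [IV] displays are TESTED at `U = (1, 0)` on every run in the window -/

section NonVacuity
variable (Θ : Stage13Params F N) (lam : ResidW F N) (σ : ∀ P : B12.RunParams, Sit189 F N P.K)
  (s : ∀ P : B12.RunParams, SeqOfRecord F Θ.ν Θ.τ9.M (gOfRecord₁₃ F N (Θ.liveRepin₁₃ F N) P) P.K (lam.kSel P + 1)) (Nm N₀ : B12.RunParams → ℕ) (p₁ : ℕ)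

/-- **BOTH [IV] DISPLAYS TESTED AT THE UNIT CONFIGURATION AT `λᵀ` ON THE LIVE LINE, ADMISSIBILITY DISCHARGED** (module 14's `displays_tested_at_one_pinD189TH` with `0 < εreg`, `0 < A₀`,
`0 < A₁`, `γ < 1` READ OFF `Θ.Admissible`): for a run whose ₁₃ history lies in `]0, Θ.γ]` up to `n ≥ kSel P + 1` and residual numbers `0 ≤ β < 1`, `0 < L₀`, `0 ≤ O(1)B₃B₅`, at `U = (1, 0)` the
antecedent `new189` HOLDS, the (1.80) body HOLDS and `χ″_k` HOLDS. [cite: Balaban1989LargeFieldI, (1.80) p.195, (1.82) p.196, (1.89) p.198, (1.24) p.182; Balaban1988Convergent, (2.4) p.255 (bookkeeping witness)] -/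
theorem displays_tested_at_one_pinAllTH_liveRepin₁₃ (hθ : Θ.Admissible F N) (P : B12.RunParams) {n : ℕ}
    (hI : Step.InInterval Θ.γ n (gOfRecord₁₃ F N (Θ.liveRepin₁₃ F N) P)) (hkn : lam.kSel P + 1 ≤ n)
    (hβ0 : 0 ≤ (σ P).β) (hβ1 : (σ P).β < 1) (hL₀ : 0 < (σ P).L₀) (hB : 0 ≤ (σ P).O1 * (σ P).B₃ * (σ P).B₅) :
    let D := ((lam.pinRPrime₁₃ (Θ.liveRepin₁₃ F N)).pinD189TH (Θ.liveRepin₁₃ F N).ν (Θ.liveRepin₁₃ F N).A₁ (Θ.liveRepin₁₃ F N).τ9.M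
      (gOfRecord₁₃ F N (Θ.liveRepin₁₃ F N)) σ s Nm N₀ p₁).D189 P
    new189 D ((1 : MSField (F.P P.K) (SU N)), fun _ _ => (0 : EuclideanSpace ℝ (Fin (N ^ 2 - 1)))) ∧
    (∀ i, D.h ≤ i → i ≤ D.k → ∀ q ∈ plaqsOf (dom D i),
      Ineq180 (D.dev0 ((1 : MSField (F.P P.K) (SU N)), fun _ _ => (0 : EuclideanSpace ℝ (Fin (N ^ 2 - 1)))) q) (D.ε D.k) D.η D.B₃ D.B₅ D.M D.δ (D.dist q) D.O1) ∧
    chiPP D ((1 : MSField (F.P P.K) (SU N)), fun _ _ => (0 : EuclideanSpace ℝ (Fin (N ^ 2 - 1)))) :=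
  displays_tested_at_one_pinD189TH (lam.pinRPrime₁₃ (Θ.liveRepin₁₃ F N)) (gOfRecord₁₃ F N (Θ.liveRepin₁₃ F N)) σ s Nm N₀ p₁
    hθ.1.1.1.1.2.2.1 (B15Claim189FlowAtRecord.A₀_pos_of_admissible hθ.1.1) hθ.1.2.2.2.1 hθ.1.2.2.2.2.2.2 P hI hkn hβ0 hβ1 hL₀ hB

/-- **… in particular the (1.80) ∕ (1.89) antecedent `new189 (λᵀ.D189 P) (1, 0)` HOLDS** (the ₁₃ twin of g5's `new189_pinAllT_one_zero₁₂`, admissibility now inside).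
[cite: Balaban1989LargeFieldI, (1.82) p.196, (1.89) p.198 (bookkeeping census)] -/
theorem new189_pinAllTH_liveRepin₁₃_one_zero (hθ : Θ.Admissible F N) (P : B12.RunParams) {n : ℕ}
    (hI : Step.InInterval Θ.γ n (gOfRecord₁₃ F N (Θ.liveRepin₁₃ F N) P)) (hkn : lam.kSel P + 1 ≤ n)
    (hβ0 : 0 ≤ (σ P).β) (hβ1 : (σ P).β < 1) (hL₀ : 0 < (σ P).L₀) (hB : 0 ≤ (σ P).O1 * (σ P).B₃ * (σ P).B₅) :
    new189 (((lam.pinRPrime₁₃ (Θ.liveRepin₁₃ F N)).pinD189TH (Θ.liveRepin₁₃ F N).ν (Θ.liveRepin₁₃ F N).A₁ (Θ.liveRepin₁₃ F N).τ9.M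
        (gOfRecord₁₃ F N (Θ.liveRepin₁₃ F N)) σ s Nm N₀ p₁).D189 P)
      ((1 : MSField (F.P P.K) (SU N)), fun _ _ => (0 : EuclideanSpace ℝ (Fin (N ^ 2 - 1)))) :=
  (displays_tested_at_one_pinAllTH_liveRepin₁₃ Θ lam σ s Nm N₀ p₁ hθ P hI hkn hβ0 hβ1 hL₀ hB).1

end NonVacuity

/-! ## §2 THE [IV] LEAF AT THE TERM-PINNED LAYERS OF THE LIVE RE-PIN's BUNDLE OF RECORD: (1.89) discharged, `hfib` free, pin `rfl`, live-mass -/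

section Leaf
variable (Θ : Stage13Params F N) (lam : ResidW F N) (σ : ∀ P : B12.RunParams, Sit189 F N P.K)
  (s : ∀ P : B12.RunParams, SeqOfRecord F Θ.ν Θ.τ9.M (gOfRecord₁₃ F N (Θ.liveRepin₁₃ F N) P) P.K (lam.kSel P + 1)) (Nm N₀ : B12.RunParams → ℕ) (p₁ : ℕ)

/-- **★ THE [IV] LEAF AT `WOfRecord₁₃ θL λᵀ P` (`θL := Θ.liveRepin₁₃`) FOR A RUN WITH `kSel P < K` — WINDOW-FREE FORM, NO (1.89) DISPLAY, NO `hfib`**: 12B's `b15Leaf_WOfRecord₁₃_liveRepin₁₃_of_massLive`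
at `λᵀ := (λ.pinRPrime₁₃ θL).pinD189TH θL.ν θL.A₁ θL.τ9.M (gOfRecord₁₃ θL) σ s N N₀ p₁` (pin equation `rfl`) with the `h189` slot SUPPLIED by module 14's `claim189_sitOfHist_of_flow`.  Stated with
a defining equation `hD` for the letters (instantiate `rfl`).  DISPLAYED: `Provisos₁₃` at the re-pin, positive mass of the LIVE pre-𝐑 terms at level `kSel P + 1`, Prop. 1 at `λ.LF P`, the levels
`2 ≤ N₀ P ≤ N P`, `N₀ P ≤ kSel P + 1`, the residual numerics and signs, print's two p.200 conditions (`hN₀ hMl`), the flow inputs along the ₁₃ history (`hε0 hε1 hflow`), the located geometry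
(`hZk hgeom hbox`), the four ℍ-leaves (`L91h L95 L91 L97`) and (1.80) (`L80`). [cite: Balaban1989LargeFieldI, (0.2)–(0.6) p.176, p.176 ll.14–16, Prop. 1 (1.78) p.194, (1.80) p.195, (1.88)–(1.89) p.198, pp.199–201; Balaban1988Convergent, (2.1) p.254, (2.8) p.256, (3.22)–(3.25) pp.269–270] -/
theorem b15Leaf_WOfRecord₁₃_pinAllTH_liveRepin₁₃_of_massLive_of_flow (hP : (Θ.liveRepin₁₃ F N).Provisos₁₃ F N) {P : B12.RunParams} (hK : lam.kSel P < P.K)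
    {D : Setting189 (F.P P.K) (SU N) (MSField (F.P P.K) (SU N) × ((j : ℕ) → VecField (F.P P.K) j (EuclideanSpace ℝ (Fin (N ^ 2 - 1))))) (Pt (F.P P.K).d)}
    (hD : D = ((lam.pinRPrime₁₃ (Θ.liveRepin₁₃ F N)).pinD189TH (Θ.liveRepin₁₃ F N).ν (Θ.liveRepin₁₃ F N).A₁ (Θ.liveRepin₁₃ F N).τ9.M
      (gOfRecord₁₃ F N (Θ.liveRepin₁₃ F N)) σ s Nm N₀ p₁).D189 P)
    (hmassLive : ∀ a, LiveSeq F N Θ.ν Θ.τ9 P (gOfRecord₁₃ F N (Θ.liveRepin₁₃ F N) P) (lam.kSel P + 1)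
        (slotsTOfRecord F N Θ.ν Θ.τ9 (EOfRecord₁₃ F N (Θ.liveRepin₁₃ F N)) (wOfRecord₉ F N (Θ.liveRepin₁₃ F N).toStage9Params)
          (Θ.liveRepin₁₃ F N).ppSel P (gOfRecord₁₃ F N (Θ.liveRepin₁₃ F N) P) (lam.kSel P + 1)) a →
      0 < ∫ V, rterm (reprTOfRecord₁₃ F N (Θ.liveRepin₁₃ F N) P (lam.kSel P)) a V ∂(fieldMeasure (F.P P.K) (lam.kSel P + 1) (SU N)))
    (hP1 : Prop1Printed (lam.LF P))
    -- levels, residual numerics, print's two conditions (p. 200)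
    (hN2 : 2 ≤ N₀ P) (hNN : N₀ P ≤ Nm P) (hNk : N₀ P ≤ lam.kSel P + 1)
    (hβ0 : 0 ≤ (σ P).β) (hβ : (σ P).β ≤ 1 / 4) (hL₀ : 2 ≤ (σ P).L₀) (hL₀L : (σ P).L₀ ^ 2 ≤ ((F.P P.K).L : ℝ))
    (hB : 0 ≤ (σ P).O1 * (σ P).B₃ * (σ P).B₅) (hδ : 0 ≤ (σ P).δ) (hdist : ∀ p, 0 ≤ (σ P).dist p)
    (hN₀ : (2 + (121 / 120) ^ 2 * ((σ P).O1 * (σ P).B₃ * (σ P).B₅ * (Θ.τ9.M : ℝ) ^ 5)) * ((((σ P).L₀ ^ 2) ^ (N₀ P - 1))⁻¹) ≤ 1 / 4)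
    (hMl : (121 / 120) ^ 2 * ((σ P).O1 * (σ P).B₃ * (σ P).B₅ * (Θ.τ9.M : ℝ) ^ 5) * Real.exp (-(4 * (σ P).δ * (Θ.τ9.M : ℝ))) ≤ 1 / 12)
    -- the flow inputs along the Stage-13 history (window-free)
    (hε0 : ∀ i, lam.kSel P + 1 - Nm P ≤ i → i ≤ lam.kSel P + 1 → 0 ≤ epsOfRecord Θ.ν (gOfRecord₁₃ F N (Θ.liveRepin₁₃ F N) P) i)
    (hε1 : ∀ i, lam.kSel P + 1 - Nm P ≤ i → i ≤ lam.kSel P + 1 → epsOfRecord Θ.ν (gOfRecord₁₃ F N (Θ.liveRepin₁₃ F N) P) i ≤ 1 / 10)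
    {β₀ : ℝ} (hβ₀0 : 0 ≤ β₀) (hβ₀ : β₀ ≤ 1 / 2)
    (hflow : ∀ j, lam.kSel P + 1 - Nm P ≤ j → j < lam.kSel P + 1 → epsOfRecord Θ.ν (gOfRecord₁₃ F N (Θ.liveRepin₁₃ F N) P) (lam.kSel P + 1)
      ≤ (1 + β₀) * Real.sqrt ((lam.kSel P + 1 - j : ℕ) : ℝ) * epsOfRecord Θ.ν (gOfRecord₁₃ F N (Θ.liveRepin₁₃ F N) P) j)
    -- located geometry
    (hZk : ∀ m, lam.kSel P + 1 - N₀ P < m → m < lam.kSel P + 1 → (σ P).Zpp (lam.kSel P + 1) ∩ omegaOfChain (s P) m ⊆ omegaOfChain (s P) (m + 1))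
    (hgeom : ∀ m, D.k₀ < m → m < D.k → ∀ p ∈ plaqsOf (D.Ω m \ D.Ω (m + 1)), 4 * ((m : ℝ) - D.k₀) * D.M ≤ D.dist p)
    (hbox : ∀ p ∈ plaqsOf (half D), D.boxOf p ∈ D.halfcubes ∧ p ∈ D.plaqT (D.boxOf p))
    -- the four ℍ-leaves and (1.80)
    (L91h : ∀ U, new189 D U → ∀ p ∈ plaqsOf (half D),
      Ineq191 (dist1 (plaqHol (D.Upp U) p)) (D.devV'' U p) D.α ((D.L ^ D.h)⁻¹) (D.ε D.h) (E124 D.ε D.L D.η D.k D.h))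
    (L95 : ∀ U, new189 D U → ∀ p ∈ plaqsOf (half D),
      Ineq195 (D.devV'' U p) (dist1 (plaqHol (D.Uhalf U (D.boxOf p)) p)) D.α ((D.L ^ D.h)⁻¹) (D.ε D.h) (E124 D.ε D.L D.η D.k D.h))
    (L91 : ∀ U, new189 D U → ∀ j, D.h ≤ j → j ≤ D.k → ∀ p ∈ plaqsOf (dom D j),
      Ineq191 (dist1 (plaqHol (D.Upp U) p)) (D.dev97 U p) D.α ((D.L ^ j)⁻¹) (D.ε j) (E124 D.ε D.L D.η D.k j))
    (L97 : ∀ U, new189 D U → ∀ j, D.h ≤ j → j ≤ D.k → ∀ p ∈ plaqsOf (dom D j),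
      Ineq191 (D.dev97 U p) (D.dev0 U p) D.α ((D.L ^ j)⁻¹) (D.ε j) (E124 D.ε D.L D.η D.k j))
    (L80 : ∀ U, new189 D U → ∀ j, D.h ≤ j → j ≤ D.k → ∀ p ∈ plaqsOf (dom D j),
      Ineq180 (D.dev0 U p) (D.ε D.k) D.η D.B₃ D.B₅ D.M D.δ (D.dist p) D.O1) :
    B15Leaf (WOfRecord₁₃ F N (Θ.liveRepin₁₃ F N)
      ((lam.pinRPrime₁₃ (Θ.liveRepin₁₃ F N)).pinD189TH (Θ.liveRepin₁₃ F N).ν (Θ.liveRepin₁₃ F N).A₁ (Θ.liveRepin₁₃ F N).τ9.M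
        (gOfRecord₁₃ F N (Θ.liveRepin₁₃ F N)) σ s Nm N₀ p₁) P) := by
  subst hD
  exact b15Leaf_WOfRecord₁₃_liveRepin₁₃_of_massLive Θ _ hP hK rfl hmassLive hP1 (fun U hU i hi hik q hq => L80 U hU i hi hik q hq)
    (claim189_sitOfHist_of_flow (Nm P) P (σ P) (s P) (N₀ P) p₁ rfl hN2 hNN hNk hβ0 hβ hL₀ hL₀L hB hδ hdist hN₀ hMl hε0 hε1 hβ₀0 hβ₀ hflow hZk hgeom
      hbox L91h L95 L91 L97 L80)

/-- **★ THE SAME WITH `N₀ P := N₀ OF RECORD 13` FOR A RUN IN A (2.7)-SMALL WINDOW** (module 14's `claim189_sitOfHist₁₃_N0_of_inInterval`): the layer `λᴺ := λᵀ` at `N₀ P := N0OfRecord₁₃ θL P (kSel P + 1)`;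
`2 ≤ N₀` from `r ≥ 1`, print's FIRST p.200 condition from ONE threshold on `g_{kSel P + 1}` (`hwin`) and `β₁₃ ≥ 0` along the history (`hβhist`), the flow inputs from the window `]0, Θ.γ]` up to
`kSel P + 1` with the BOX bound `BetaUpperH β′ Θ.γ (betaOfRecord₁₃ θL)` and `SmallnessFor Θ.γ β′ β₀ L p₀` (so `γ < ½`: the form for K0a's all-numerics members with small `n.γ`, NOT for the
witness of record whose `γ = ½`).  DISPLAYED otherwise as in the window-free form. [cite: Balaban1989LargeFieldI, (0.2)–(0.6) p.176, Prop. 1 (1.78) p.194, (1.80) p.195, (1.88)–(1.89) p.198, pp.199–201; Balaban1988Convergent, (2.1) p.254, (2.4)–(2.8) pp.255–256; Balaban1987RG1, (1.22) p.264] -/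
theorem b15Leaf_WOfRecord₁₃_pinAllTH_N0_liveRepin₁₃_of_massLive_of_h180 (hP : (Θ.liveRepin₁₃ F N).Provisos₁₃ F N) {P : B12.RunParams} (hK : lam.kSel P < P.K)
    {D : Setting189 (F.P P.K) (SU N) (MSField (F.P P.K) (SU N) × ((j : ℕ) → VecField (F.P P.K) j (EuclideanSpace ℝ (Fin (N ^ 2 - 1))))) (Pt (F.P P.K).d)}
    (hD : D = ((lam.pinRPrime₁₃ (Θ.liveRepin₁₃ F N)).pinD189TH (Θ.liveRepin₁₃ F N).ν (Θ.liveRepin₁₃ F N).A₁ (Θ.liveRepin₁₃ F N).τ9.M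
      (gOfRecord₁₃ F N (Θ.liveRepin₁₃ F N)) σ s Nm (fun P => N0OfRecord₁₃ (Θ.liveRepin₁₃ F N) P (lam.kSel P + 1)) p₁).D189 P)
    (hmassLive : ∀ a, LiveSeq F N Θ.ν Θ.τ9 P (gOfRecord₁₃ F N (Θ.liveRepin₁₃ F N) P) (lam.kSel P + 1)
        (slotsTOfRecord F N Θ.ν Θ.τ9 (EOfRecord₁₃ F N (Θ.liveRepin₁₃ F N)) (wOfRecord₉ F N (Θ.liveRepin₁₃ F N).toStage9Params)
          (Θ.liveRepin₁₃ F N).ppSel P (gOfRecord₁₃ F N (Θ.liveRepin₁₃ F N) P) (lam.kSel P + 1)) a →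
      0 < ∫ V, rterm (reprTOfRecord₁₃ F N (Θ.liveRepin₁₃ F N) P (lam.kSel P)) a V ∂(fieldMeasure (F.P P.K) (lam.kSel P + 1) (SU N)))
    (hP1 : Prop1Printed (lam.LF P))
    -- memory, residual numerics, print's second condition (p. 200), its first via the threshold
    (hr : 1 ≤ Θ.ν.r) (hNN : N0OfRecord₁₃ (Θ.liveRepin₁₃ F N) P (lam.kSel P + 1) ≤ Nm P) (hNk : N0OfRecord₁₃ (Θ.liveRepin₁₃ F N) P (lam.kSel P + 1) ≤ lam.kSel P + 1)
    (hβ0 : 0 ≤ (σ P).β) (hβ : (σ P).β ≤ 1 / 4) (hL₀ : 2 ≤ (σ P).L₀) (hL₀L : (σ P).L₀ ^ 2 ≤ ((F.P P.K).L : ℝ))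
    (hB : 0 ≤ (σ P).O1 * (σ P).B₃ * (σ P).B₅) (hδ : 0 ≤ (σ P).δ) (hdist : ∀ p, 0 ≤ (σ P).dist p)
    (hwin : 4 * (2 + (121 / 120) ^ 2 * ((σ P).O1 * (σ P).B₃ * (σ P).B₅ * (Θ.τ9.M : ℝ) ^ 5))
      ≤ ((Real.log (gOfRecord₁₃ F N (Θ.liveRepin₁₃ F N) P (lam.kSel P + 1) ^ 2)⁻¹) ^ Θ.ν.r) ^ (Real.log ((σ P).L₀ ^ 2) / Real.log ((F.P P.K).L : ℝ)))
    (hβhist : ∀ j, j < lam.kSel P + 1 → 0 ≤ betaOfRecord₁₃ F N (Θ.liveRepin₁₃ F N) j (prefixOf (gOfRecord₁₃ F N (Θ.liveRepin₁₃ F N) P) j))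
    (hMl : (121 / 120) ^ 2 * ((σ P).O1 * (σ P).B₃ * (σ P).B₅ * (Θ.τ9.M : ℝ) ^ 5) * Real.exp (-(4 * (σ P).δ * (Θ.τ9.M : ℝ))) ≤ 1 / 12)
    -- flow numerics, the run's window, the β-box bound
    (hA₀ : 0 ≤ Θ.ν.A₀) {β' β₀ : ℝ} {L : ℕ} (S : SmallnessFor Θ.γ β' β₀ L Θ.ν.p₀) (hβ₀ : β₀ ≤ 1 / 2) (hε10 : Θ.γ * p0Profile Θ.ν.A₀ Θ.ν.p₀ Θ.γ ≤ 1 / 10)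
    (hI : Step.InInterval Θ.γ (lam.kSel P + 1) (gOfRecord₁₃ F N (Θ.liveRepin₁₃ F N) P)) (hup : BetaUpperH β' Θ.γ (betaOfRecord₁₃ F N (Θ.liveRepin₁₃ F N)))
    -- located geometry
    (hZk : ∀ m, lam.kSel P + 1 - N0OfRecord₁₃ (Θ.liveRepin₁₃ F N) P (lam.kSel P + 1) < m → m < lam.kSel P + 1 →
      (σ P).Zpp (lam.kSel P + 1) ∩ omegaOfChain (s P) m ⊆ omegaOfChain (s P) (m + 1))
    (hgeom : ∀ m, D.k₀ < m → m < D.k → ∀ p ∈ plaqsOf (D.Ω m \ D.Ω (m + 1)), 4 * ((m : ℝ) - D.k₀) * D.M ≤ D.dist p)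
    (hbox : ∀ p ∈ plaqsOf (half D), D.boxOf p ∈ D.halfcubes ∧ p ∈ D.plaqT (D.boxOf p))
    -- the four ℍ-leaves and (1.80)
    (L91h : ∀ U, new189 D U → ∀ p ∈ plaqsOf (half D),
      Ineq191 (dist1 (plaqHol (D.Upp U) p)) (D.devV'' U p) D.α ((D.L ^ D.h)⁻¹) (D.ε D.h) (E124 D.ε D.L D.η D.k D.h))
    (L95 : ∀ U, new189 D U → ∀ p ∈ plaqsOf (half D),
      Ineq195 (D.devV'' U p) (dist1 (plaqHol (D.Uhalf U (D.boxOf p)) p)) D.α ((D.L ^ D.h)⁻¹) (D.ε D.h) (E124 D.ε D.L D.η D.k D.h))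
    (L91 : ∀ U, new189 D U → ∀ j, D.h ≤ j → j ≤ D.k → ∀ p ∈ plaqsOf (dom D j),
      Ineq191 (dist1 (plaqHol (D.Upp U) p)) (D.dev97 U p) D.α ((D.L ^ j)⁻¹) (D.ε j) (E124 D.ε D.L D.η D.k j))
    (L97 : ∀ U, new189 D U → ∀ j, D.h ≤ j → j ≤ D.k → ∀ p ∈ plaqsOf (dom D j),
      Ineq191 (D.dev97 U p) (D.dev0 U p) D.α ((D.L ^ j)⁻¹) (D.ε j) (E124 D.ε D.L D.η D.k j))
    (L80 : ∀ U, new189 D U → ∀ j, D.h ≤ j → j ≤ D.k → ∀ p ∈ plaqsOf (dom D j),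
      Ineq180 (D.dev0 U p) (D.ε D.k) D.η D.B₃ D.B₅ D.M D.δ (D.dist p) D.O1) :
    B15Leaf (WOfRecord₁₃ F N (Θ.liveRepin₁₃ F N)
      ((lam.pinRPrime₁₃ (Θ.liveRepin₁₃ F N)).pinD189TH (Θ.liveRepin₁₃ F N).ν (Θ.liveRepin₁₃ F N).A₁ (Θ.liveRepin₁₃ F N).τ9.M
        (gOfRecord₁₃ F N (Θ.liveRepin₁₃ F N)) σ s Nm (fun P => N0OfRecord₁₃ (Θ.liveRepin₁₃ F N) P (lam.kSel P + 1)) p₁) P) := by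
  subst hD
  exact b15Leaf_WOfRecord₁₃_liveRepin₁₃_of_massLive Θ _ hP hK rfl hmassLive hP1 (fun U hU i hi hik q hq => L80 U hU i hi hik q hq)
    (claim189_sitOfHist₁₃_N0_of_inInterval (θ := Θ.liveRepin₁₃ F N) (Nm P) P (σ P) (s P) p₁ rfl hr hNN hNk hβ0 hβ hL₀ hL₀L hB hδ hdist hwin hβhist hMl
      hA₀ S hβ₀ hε10 hI hup hZk hgeom hbox L91h L95 L91 L97 L80)

/-- **★ THE SAME WITH PRINT's `Z″_j` PINNED TO THE TERM'S CHAIN, WINDOW-FREE** (module 14's `claim189_sitOfHist_N0Z_of_flow` at the layer `λᶻ := (λ.pinRPrime₁₃ θL).pinD189ZH … enl p₁`,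
`N₀ P := N0OfRecord₁₃ θL P (kSel P + 1)`, enlargement inflationary): the located input «We have j = k» (`hZk`) is DISCHARGED; `2 ≤ N₀` displayed at its source `1 < (log g⁻²)^r`, print's first
condition displayed as `hN₀`. [cite: Balaban1989LargeFieldI, (0.2)–(0.6) p.176, Prop. 1 (1.78) p.194, (1.80) p.195, (1.10)–(1.11) p.179, (1.88)–(1.89) p.198, pp.199–201; Balaban1988Convergent, (2.1) p.254, (2.5)–(2.8) pp.255–256] -/
theorem b15Leaf_WOfRecord₁₃_pinAllZH_N0_liveRepin₁₃_of_massLive_of_flow (hP : (Θ.liveRepin₁₃ F N).Provisos₁₃ F N)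
    (enl : ∀ P : B12.RunParams, ℕ → ℕ → Set (Site (F.P P.K) 0) → Set (Site (F.P P.K) 0)) {P : B12.RunParams} (hK : lam.kSel P < P.K)
    (henl : ∀ n j (S : Set (Site (F.P P.K) 0)), S ⊆ enl P n j S)
    {D : Setting189 (F.P P.K) (SU N) (MSField (F.P P.K) (SU N) × ((j : ℕ) → VecField (F.P P.K) j (EuclideanSpace ℝ (Fin (N ^ 2 - 1))))) (Pt (F.P P.K).d)}
    (hD : D = ((lam.pinRPrime₁₃ (Θ.liveRepin₁₃ F N)).pinD189ZH (Θ.liveRepin₁₃ F N).ν (Θ.liveRepin₁₃ F N).A₁ (Θ.liveRepin₁₃ F N).τ9.M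
      (gOfRecord₁₃ F N (Θ.liveRepin₁₃ F N)) σ s Nm (fun P => N0OfRecord₁₃ (Θ.liveRepin₁₃ F N) P (lam.kSel P + 1)) enl p₁).D189 P)
    (hmassLive : ∀ a, LiveSeq F N Θ.ν Θ.τ9 P (gOfRecord₁₃ F N (Θ.liveRepin₁₃ F N) P) (lam.kSel P + 1)
        (slotsTOfRecord F N Θ.ν Θ.τ9 (EOfRecord₁₃ F N (Θ.liveRepin₁₃ F N)) (wOfRecord₉ F N (Θ.liveRepin₁₃ F N).toStage9Params)
          (Θ.liveRepin₁₃ F N).ppSel P (gOfRecord₁₃ F N (Θ.liveRepin₁₃ F N) P) (lam.kSel P + 1)) a →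
      0 < ∫ V, rterm (reprTOfRecord₁₃ F N (Θ.liveRepin₁₃ F N) P (lam.kSel P)) a V ∂(fieldMeasure (F.P P.K) (lam.kSel P + 1) (SU N)))
    (hP1 : Prop1Printed (lam.LF P))
    (hlog : 1 < (Real.log (gOfRecord₁₃ F N (Θ.liveRepin₁₃ F N) P (lam.kSel P + 1) ^ 2)⁻¹) ^ Θ.ν.r)
    (hNN : N0OfRecord₁₃ (Θ.liveRepin₁₃ F N) P (lam.kSel P + 1) ≤ Nm P) (hNk : N0OfRecord₁₃ (Θ.liveRepin₁₃ F N) P (lam.kSel P + 1) ≤ lam.kSel P + 1)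
    (hβ0 : 0 ≤ (σ P).β) (hβ : (σ P).β ≤ 1 / 4) (hL₀ : 2 ≤ (σ P).L₀) (hL₀L : (σ P).L₀ ^ 2 ≤ ((F.P P.K).L : ℝ))
    (hB : 0 ≤ (σ P).O1 * (σ P).B₃ * (σ P).B₅) (hδ : 0 ≤ (σ P).δ) (hdist : ∀ p, 0 ≤ (σ P).dist p)
    (hN₀ : (2 + (121 / 120) ^ 2 * ((σ P).O1 * (σ P).B₃ * (σ P).B₅ * (Θ.τ9.M : ℝ) ^ 5)) *
      ((((σ P).L₀ ^ 2) ^ (N0OfRecord₁₃ (Θ.liveRepin₁₃ F N) P (lam.kSel P + 1) - 1))⁻¹) ≤ 1 / 4)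
    (hMl : (121 / 120) ^ 2 * ((σ P).O1 * (σ P).B₃ * (σ P).B₅ * (Θ.τ9.M : ℝ) ^ 5) * Real.exp (-(4 * (σ P).δ * (Θ.τ9.M : ℝ))) ≤ 1 / 12)
    (hε0 : ∀ i, lam.kSel P + 1 - Nm P ≤ i → i ≤ lam.kSel P + 1 → 0 ≤ epsOfRecord Θ.ν (gOfRecord₁₃ F N (Θ.liveRepin₁₃ F N) P) i)
    (hε1 : ∀ i, lam.kSel P + 1 - Nm P ≤ i → i ≤ lam.kSel P + 1 → epsOfRecord Θ.ν (gOfRecord₁₃ F N (Θ.liveRepin₁₃ F N) P) i ≤ 1 / 10)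
    {β₀ : ℝ} (hβ₀0 : 0 ≤ β₀) (hβ₀ : β₀ ≤ 1 / 2)
    (hflow : ∀ j, lam.kSel P + 1 - Nm P ≤ j → j < lam.kSel P + 1 → epsOfRecord Θ.ν (gOfRecord₁₃ F N (Θ.liveRepin₁₃ F N) P) (lam.kSel P + 1)
      ≤ (1 + β₀) * Real.sqrt ((lam.kSel P + 1 - j : ℕ) : ℝ) * epsOfRecord Θ.ν (gOfRecord₁₃ F N (Θ.liveRepin₁₃ F N) P) j)
    (hgeom : ∀ m, D.k₀ < m → m < D.k → ∀ p ∈ plaqsOf (D.Ω m \ D.Ω (m + 1)), 4 * ((m : ℝ) - D.k₀) * D.M ≤ D.dist p)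
    (hbox : ∀ p ∈ plaqsOf (half D), D.boxOf p ∈ D.halfcubes ∧ p ∈ D.plaqT (D.boxOf p))
    (L91h : ∀ U, new189 D U → ∀ p ∈ plaqsOf (half D),
      Ineq191 (dist1 (plaqHol (D.Upp U) p)) (D.devV'' U p) D.α ((D.L ^ D.h)⁻¹) (D.ε D.h) (E124 D.ε D.L D.η D.k D.h))
    (L95 : ∀ U, new189 D U → ∀ p ∈ plaqsOf (half D),
      Ineq195 (D.devV'' U p) (dist1 (plaqHol (D.Uhalf U (D.boxOf p)) p)) D.α ((D.L ^ D.h)⁻¹) (D.ε D.h) (E124 D.ε D.L D.η D.k D.h))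
    (L91 : ∀ U, new189 D U → ∀ j, D.h ≤ j → j ≤ D.k → ∀ p ∈ plaqsOf (dom D j),
      Ineq191 (dist1 (plaqHol (D.Upp U) p)) (D.dev97 U p) D.α ((D.L ^ j)⁻¹) (D.ε j) (E124 D.ε D.L D.η D.k j))
    (L97 : ∀ U, new189 D U → ∀ j, D.h ≤ j → j ≤ D.k → ∀ p ∈ plaqsOf (dom D j),
      Ineq191 (D.dev97 U p) (D.dev0 U p) D.α ((D.L ^ j)⁻¹) (D.ε j) (E124 D.ε D.L D.η D.k j))
    (L80 : ∀ U, new189 D U → ∀ j, D.h ≤ j → j ≤ D.k → ∀ p ∈ plaqsOf (dom D j),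
      Ineq180 (D.dev0 U p) (D.ε D.k) D.η D.B₃ D.B₅ D.M D.δ (D.dist p) D.O1) :
    B15Leaf (WOfRecord₁₃ F N (Θ.liveRepin₁₃ F N)
      ((lam.pinRPrime₁₃ (Θ.liveRepin₁₃ F N)).pinD189ZH (Θ.liveRepin₁₃ F N).ν (Θ.liveRepin₁₃ F N).A₁ (Θ.liveRepin₁₃ F N).τ9.M
        (gOfRecord₁₃ F N (Θ.liveRepin₁₃ F N)) σ s Nm (fun P => N0OfRecord₁₃ (Θ.liveRepin₁₃ F N) P (lam.kSel P + 1)) enl p₁) P) := by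
  subst hD
  exact b15Leaf_WOfRecord₁₃_liveRepin₁₃_of_massLive Θ _ hP hK rfl hmassLive hP1 (fun U hU i hi hik q hq => L80 U hU i hi hik q hq)
    (claim189_sitOfHist_N0Z_of_flow (Nm P) P (σ P) (s P) p₁ (enl P) henl rfl hlog hNN hNk hβ0 hβ hL₀ hL₀L hB hδ hdist hN₀ hMl hε0 hε1 hβ₀0 hβ₀ hflow
      hgeom hbox L91h L95 L91 L97 L80)

end Leaf

end Summit.QuantumFields.YangMills.BalabanUVNodes.N12AtRecord13TermPinned
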